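import Literature.Probability.Percolation.SqAnnulusDualBarrier
import Literature.Probability.Percolation.LowestCrossingInterface
import Literature.Probability.Percolation.ZdFiveArmMonotone
import Literature.Probability.Percolation.BondPercolationSymmetry
import Literature.Probability.Percolation.FourArmGarbanFencedArms
import Literature.Probability.Percolation.FourArmGarbanDocking
import Literature.Probability.Percolation.ZdFiveArmPointBoundOfSeparation
import HarnessLib

/-!
# Five-arm points on the lowest crossing of a square: the deterministic core

Topic `Literature/Probability/Percolation`; proofs only (no definition of an event, no named fact).
This is the combinatorial heart of the **five-arm lower bound** for critical bond percolation on
`ℤ²` in the form used by Kesten–Sidoravicius–Zhang and Nolin (Nolin 2008, §5.2, proof of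
Thm. 24 (ii) [arXiv 0711.4948: Thm. 23 (ii)]: "condition on the lowest black left–right crossing
`c`; any site on this crossing has already 3 arms … consider the … vertex `v` [where a path from
the top arrives]: it is not hard to see that there is a white arm from `v` …"; Kesten–Sidoravicius–
Zhang 1998, proof of Lemma 5, (3.17)–(3.18) and Fig. 3).

Let `π` be the lowest open left–right crossing of the square `S = [0, j]²` (the boundary crossing
of `LowestCrossing.lean` for `D₀ = dualBelow j ω`, made into a path), `v` an interior vertex of `π`,
`{v, t}` an OPEN *landing edge* at `v` whose other endpoint `t` is strictly above `π` (all faces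
around `t` have winding number `≠ -1` for the extended crossing `P̂`), `P` an open walk from `t`
avoiding `π` (the arm to the top side), and `Δ` a walk of faces starting at a face `h₁` of the
landing edge, every step of which crosses a CLOSED edge (the fifth, dual arm).  We prove
(`relabel_shift_mem_zdFiveArmClusters_of_arms`): if around a centre `z` with `‖v - z‖_∞ ≤ m - 1`
the walks `P`, `π[a, v]`, `π[v, b]` all leave the box `z + Λ_{n-1}`, the dual arm `Δ` ends above
the box `z + Λ_n` and the bottom row of faces lies below it, then the configuration translated by
`-z` lies in the cluster-form five-arm event `zdFiveArmClusters m n` (`ZdFourArmFromFiveArm.lean`).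

The three open arms are trimmed sub-walks of `v :: P`, `π[a, v]`, `π[v, b]`; the two dual arms
are `Δ` and the dual-open path joining the `D₀`-face of an edge of `π` at `v` to the bottom row
(`exists_openConnIn_dualBelow`).  That the first two open arms lie in distinct open clusters of
the annulus is a discrete Jordan-curve argument by winding numbers (Kesten 1982, §2.2): a
connection inside the annulus would close up, with the inner pieces of the two arms, to a closed
open walk `C` through `v` using exactly the landing edge and one edge of `π` at `v`; the faces
`h₁` and `g` (the `D₀`-face) then have different winding numbers for `C`
(`walkWinding_vxFace_ne`, the local analysis around `v`), while both are joined by walks of faces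
crossing only closed edges to faces far above, resp. far below, `C`, where the winding number
vanishes.

## References

* P. Nolin, *Near-critical percolation in two dimensions*, EJP 13 (2008), §5.2, Thm. 24 (ii)
  [arXiv 0711.4948, Thm. 23 (ii)]. [Nolin2008]
* H. Kesten, V. Sidoravicius, Y. Zhang, *Almost all words are seen in critical site percolation on
  the triangular lattice*, EJP 3 (1998), paper 10, proof of Lemma 5. [KestenSidoraviciusZhang1998]
* H. Kesten, *Percolation theory for mathematicians*, Birkhäuser (1982), §2.2–2.3. [KestenPTM1982]
-/

noncomputable section

open SimpleGraph MeasureTheory Set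

namespace Literature.Probability.Percolation

open LatticeModels

/-! ### The four faces and the four edges around a vertex -/

section Around

variable (v : Site 2)

/-- The four faces around `v` (lower-left corners), counterclockwise: `F₀ = v` (NE), `F₁ = v - e₀`
(NW), `F₂ = v - e₀ - e₁` (SW), `F₃ = v - e₁` (SE). [folklore] -/
def vxFace : Fin 4 → Site 2 :=
  ![v, v - Pi.single 0 1, v - Pi.single 0 1 - Pi.single 1 1, v - Pi.single 1 1]

/-- The four lattice edges at `v`, numbered so that `vxEdge v k` separates `vxFace v (k - 1)` from
`vxFace v k`: `E₀ = {v, v + e₀}`, `E₁ = {v, v + e₁}`, `E₂ = {v - e₀, v}`, `E₃ = {v - e₁, v}`.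
[folklore] -/
def vxEdge : Fin 4 → Sym2 (Site 2) :=
  ![s(v, v + Pi.single 0 1), s(v, v + Pi.single 1 1), s(v - Pi.single 0 1, v), s(v - Pi.single 1 1, v)]

variable {v}

/-- The NE face. [folklore] -/
@[simp] theorem vxFace_zero : vxFace v 0 = v := rfl
/-- The NW face. [folklore] -/
@[simp] theorem vxFace_one : vxFace v 1 = v - Pi.single 0 1 := rfl
/-- The SW face. [folklore] -/
@[simp] theorem vxFace_two : vxFace v 2 = v - Pi.single 0 1 - Pi.single 1 1 := rfl
/-- The SE face. [folklore] -/
@[simp] theorem vxFace_three : vxFace v 3 = v - Pi.single 1 1 := rfl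
/-- The SE face (index `-1`). [folklore] -/
@[simp] theorem vxFace_neg_one : vxFace v (-1) = v - Pi.single 1 1 := rfl
/-- The edge to the right. [folklore] -/
@[simp] theorem vxEdge_zero : vxEdge v 0 = s(v, v + Pi.single 0 1) := rfl
/-- The edge upwards. [folklore] -/
@[simp] theorem vxEdge_one : vxEdge v 1 = s(v, v + Pi.single 1 1) := rfl
/-- The edge to the left. [folklore] -/
@[simp] theorem vxEdge_two : vxEdge v 2 = s(v - Pi.single 0 1, v) := rfl
/-- The edge downwards. [folklore] -/
@[simp] theorem vxEdge_three : vxEdge v 3 = s(v - Pi.single 1 1, v) := rfl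
/-- The edge downwards (index `-1`). [folklore] -/
@[simp] theorem vxEdge_neg_one : vxEdge v (-1) = s(v - Pi.single 1 1, v) := rfl

/-- `v` is an endpoint of each `vxEdge v k`. [folklore] -/
theorem mem_vxEdge (k : Fin 4) : v ∈ vxEdge v k := by
  fin_cases k <;> simp [vxEdge]

/-- The edges at `v` are lattice edges. [folklore] -/
theorem vxEdge_mem_edgeSet (k : Fin 4) : vxEdge v k ∈ (zdGraph 2).edgeSet := by
  fin_cases k
  · exact (zdGraph 2).mem_edgeSet.2 (adj_of_stepKind (.right (by simp) (by simp)))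
  · exact (zdGraph 2).mem_edgeSet.2 (adj_of_stepKind (.up (by simp) (by simp)))
  · exact (zdGraph 2).mem_edgeSet.2 (adj_of_stepKind (.right (by simp) (by simp)))
  · exact (zdGraph 2).mem_edgeSet.2 (adj_of_stepKind (.up (by simp) (by simp)))

/-- Consecutive faces around `v` are lattice-adjacent. [folklore] -/
theorem adj_vxFace (k : Fin 4) : (zdGraph 2).Adj (vxFace v (k - 1)) (vxFace v k) := by
  fin_cases k
  · exact adj_of_stepKind (.up (by simp) (by simp))
  · exact adj_of_stepKind (.left (by simp) (by simp))
  · exact adj_of_stepKind (.down (by simp) (by simp))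
  · exact adj_of_stepKind (.right (by simp) (by simp))

/-- `sepEdge` of a face and the face above it, at a general base point. [folklore] -/
private theorem sepEdge_up' (w : Site 2) :
    sepEdge w (w + Pi.single 1 1) = s(w + Pi.single 1 1, w + Pi.single 1 1 + Pi.single 0 1) := sepEdge_up w

/-- `sepEdge` of a face and the face to its right, at a general base point. [folklore] -/
private theorem sepEdge_right' (w : Site 2) :
    sepEdge w (w + Pi.single 0 1) = s(w + Pi.single 0 1, w + Pi.single 0 1 + Pi.single 1 1) := sepEdge_right w

/-- **`vxEdge v k` is the primal edge separating `vxFace v (k-1)` from `vxFace v k`.** [folklore] -/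
theorem sepEdge_vxFace (k : Fin 4) : sepEdge (vxFace v (k - 1)) (vxFace v k) = vxEdge v k := by
  fin_cases k
  · -- faces SE → NE
    have h := sepEdge_up' (v - Pi.single 1 1)
    simp only [sub_add_cancel] at h
    simpa using h
  · -- NE → NW
    have h := sepEdge_right' (v - Pi.single 0 1)
    simp only [sub_add_cancel] at h
    rw [sepEdge_comm] at h
    simpa using h
  · -- NW → SW
    have h := sepEdge_up' (v - Pi.single 0 1 - Pi.single 1 1)
    simp only [sub_add_cancel] at h
    rw [sepEdge_comm] at h
    simp only [Fin.reduceFinMk, vxFace_one, vxFace_two, vxEdge_two, Fin.isValue, Fin.reduceSub]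
    rw [h]
  · -- SW → SE
    have h := sepEdge_right' (v - Pi.single 0 1 - Pi.single 1 1)
    have e1 : v - Pi.single 0 1 - Pi.single 1 1 + Pi.single 0 1 = v - Pi.single 1 1 := by
      ext i; fin_cases i <;> simp
    rw [e1] at h
    simp only [Fin.reduceFinMk, vxFace_two, vxFace_three, vxEdge_three, Fin.isValue, Fin.reduceSub]
    rw [h]
    congr 1
    ext i; fin_cases i <;> simp

/-- The dual edge of `vxEdge v k` joins `vxFace v (k-1)` and `vxFace v k`. [folklore] -/
theorem dualEdge_vxEdge (k : Fin 4) : dualEdge (vxEdge v k) = s(vxFace v (k - 1), vxFace v k) := by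
  rw [← sepEdge_vxFace k, dualEdge_sepEdge (adj_vxFace k)]

/-- **Every lattice edge at `v` is one of the four `vxEdge v k`.** [folklore] -/
theorem exists_vxEdge_eq {e : Sym2 (Site 2)} (he : e ∈ (zdGraph 2).edgeSet) (hv : v ∈ e) :
    ∃ k : Fin 4, e = vxEdge v k := by
  induction e using Sym2.ind with
  | h x y =>
    have hadj : (zdGraph 2).Adj x y := (zdGraph 2).mem_edgeSet.1 he
    rcases Sym2.mem_iff.1 hv with rfl | rfl
    · rcases stepKind_of_adj hadj with ⟨h0, h1⟩ | ⟨h0, h1⟩ | ⟨h1, h0⟩ | ⟨h1, h0⟩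
      · refine ⟨0, ?_⟩; rw [vxEdge_zero]; congr 1; simp [Site.eq_iff_two, h0, h1]
      · refine ⟨2, ?_⟩; rw [vxEdge_two, Sym2.eq_swap]; congr 1; simp [Site.eq_iff_two, h0, h1]
      · refine ⟨1, ?_⟩; rw [vxEdge_one]; congr 1; simp [Site.eq_iff_two, h0, h1]
      · refine ⟨3, ?_⟩; rw [vxEdge_three, Sym2.eq_swap]; congr 1; simp [Site.eq_iff_two, h0, h1]
    · rcases stepKind_of_adj hadj with ⟨h0, h1⟩ | ⟨h0, h1⟩ | ⟨h1, h0⟩ | ⟨h1, h0⟩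
      · refine ⟨2, ?_⟩; rw [vxEdge_two]; congr 1; simp [Site.eq_iff_two, h0, h1]
      · refine ⟨0, ?_⟩; rw [vxEdge_zero, Sym2.eq_swap]; congr 1; simp [Site.eq_iff_two, h0, h1]
      · refine ⟨3, ?_⟩; rw [vxEdge_three]; congr 1; simp [Site.eq_iff_two, h0, h1]
      · refine ⟨1, ?_⟩; rw [vxEdge_one, Sym2.eq_swap]; congr 1; simp [Site.eq_iff_two, h0, h1]

/-- The faces of `vxEdge v k` (the members of its dual edge) are `vxFace v (k-1)` and
`vxFace v k`. [folklore] -/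
theorem mem_dualEdge_vxEdge_iff (k : Fin 4) {f : Site 2} :
    f ∈ dualEdge (vxEdge v k) ↔ f = vxFace v (k - 1) ∨ f = vxFace v k := by
  rw [dualEdge_vxEdge, Sym2.mem_iff]

/-- Coordinates of the faces around `v`: within one of `v`. [folklore] -/
theorem vxFace_apply_le (k : Fin 4) (i : Fin 2) : vxFace v k i ≤ v i ∧ v i - 1 ≤ vxFace v k i := by
  fin_cases k <;> fin_cases i <;> simp

/-- Opposite faces around `v` differ. [folklore] -/
theorem vxFace_add_two_ne (k : Fin 4) : vxFace v (k + 2) ≠ vxFace v k := by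
  intro h
  have h0 := congr_fun h 0
  have h1 := congr_fun h 1
  fin_cases k <;> (simp at h0 h1; try omega)

/-- Consecutive faces differ. [folklore] -/
theorem vxFace_sub_one_ne (k : Fin 4) : vxFace v (k - 1) ≠ vxFace v k := (adj_vxFace k).ne

/-- The next face differs. [folklore] -/
theorem vxFace_add_one_ne (k : Fin 4) : vxFace v (k + 1) ≠ vxFace v k := by
  have := vxFace_sub_one_ne (v := v) (k + 1)
  rw [add_sub_cancel_right] at this
  exact fun h => this h.symm

/-- Opposite edges at `v` differ. [folklore] -/
theorem vxEdge_add_two_ne (k : Fin 4) : vxEdge v (k + 2) ≠ vxEdge v k := by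
  intro h
  have h' := congr_arg (fun e : Sym2 (Site 2) => (v + Pi.single 0 1 ∈ e, v + Pi.single 1 1 ∈ e)) h
  fin_cases k <;> (simp [Site.eq_iff_two] at h'; try omega)

/-- Consecutive edges at `v` differ. [folklore] -/
theorem vxEdge_add_one_ne (k : Fin 4) : vxEdge v (k + 1) ≠ vxEdge v k := by
  intro h
  have h' := congr_arg (fun e : Sym2 (Site 2) => (v + Pi.single 0 1 ∈ e, v + Pi.single 1 1 ∈ e,
    v - Pi.single 0 1 ∈ e)) h
  fin_cases k <;> simp [Site.eq_iff_two] at h'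

/-- The previous edge differs. [folklore] -/
theorem vxEdge_sub_one_ne (k : Fin 4) : vxEdge v (k - 1) ≠ vxEdge v k := by
  have := vxEdge_add_one_ne (v := v) (k - 1)
  rw [sub_add_cancel] at this
  exact fun h => this h.symm

end Around

/-! ### Winding numbers of the faces around a vertex -/

section WindingAround

variable {v : Site 2}

/-- A signed indicator list with exactly one marked entry sums to `±1`. [folklore] -/
theorem sum_map_eq_one_or_of_countP {α : Type*} (l : List α) (f : α → ℤ) (P : α → Prop)
    [DecidablePred P] (h0 : ∀ x ∈ l, ¬P x → f x = 0) (h1 : ∀ x ∈ l, P x → f x = 1 ∨ f x = -1)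
    (hc : l.countP (fun x => decide (P x)) = 1) : (l.map f).sum = 1 ∨ (l.map f).sum = -1 := by
  induction l with
  | nil => simp at hc
  | cons x l ih =>
    rw [List.map_cons, List.sum_cons]
    by_cases hx : P x
    · have hl : l.countP (fun x => decide (P x)) = 0 := by
        simp only [List.countP_cons, hx, decide_true, ite_true] at hc
        omega
      have hsum : (l.map f).sum = 0 := by
        refine List.sum_eq_zero fun t ht => ?_
        obtain ⟨y, hy, rfl⟩ := List.mem_map.1 ht
        refine h0 y (List.mem_cons_of_mem _ hy) fun hPy => ?_
        have : 0 < l.countP (fun x => decide (P x)) := List.countP_pos_iff.2 ⟨y, hy, by simpa using hPy⟩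
        omega
      rw [hsum, add_zero]
      exact h1 x List.mem_cons_self hx
    · have hl : l.countP (fun x => decide (P x)) = 1 := by
        simpa [List.countP_cons, hx] using hc
      rw [h0 x List.mem_cons_self hx, zero_add]
      exact ih (fun y hy => h0 y (List.mem_cons_of_mem _ hy)) (fun y hy => h1 y (List.mem_cons_of_mem _ hy)) hl

/-- Counting an edge of a walk is counting the darts carrying it. [folklore] -/
theorem countP_darts_edge_eq {V : Type*} {G : SimpleGraph V} [DecidableEq V] {a b : V}
    (p : G.Walk a b) (e : Sym2 V) :
    p.darts.countP (fun d => decide (d.edge = e)) = p.edges.count e := by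
  rw [Walk.edges, List.count_eq_countP, List.countP_map]
  refine List.countP_congr fun d _ => ?_
  simp only [Function.comp_apply, beq_iff_eq, decide_eq_true_eq]

/-- The signed traversal count of the vertical edge `{u + e₀, u + e₀ + e₁}` by a walk using it
exactly once is `±1`. [folklore] -/
theorem sum_vCross_of_count_eq_one {a b : Site 2} (p : (zdGraph 2).Walk a b) (u : Site 2)
    (h : p.edges.count s(u + Pi.single 0 1, u + Pi.single 0 1 + Pi.single 1 1) = 1) :
    (p.darts.map fun d => vCross u d.fst d.snd).sum = 1 ∨
      (p.darts.map fun d => vCross u d.fst d.snd).sum = -1 := by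
  classical
  set ev : Sym2 (Site 2) := s(u + Pi.single 0 1, u + Pi.single 0 1 + Pi.single 1 1) with hev
  have hc : p.darts.countP (fun d => decide (d.edge = ev)) = 1 := by rw [countP_darts_edge_eq, h]
  refine sum_map_eq_one_or_of_countP p.darts (fun d => vCross u d.fst d.snd) (fun d => d.edge = ev)
    (fun d _ hd => vCross_eq_zero_of_ne fun heq => hd (by rw [hev, ← heq]; rfl)) (fun d _ hd => ?_) hc
  have hd' : s(d.fst, d.snd) = ev := hd
  rw [hev, Sym2.eq_iff] at hd'
  unfold vCross
  rcases hd' with ⟨h1, h2⟩ | ⟨h1, h2⟩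
  · left
    rw [h1, h2]
    simp
  · right
    rw [h1, h2]
    simp

/-- The signed traversal count of the horizontal edge `{u + e₁, u + e₁ + e₀}` by a walk using it
exactly once is `±1`. [folklore] -/
theorem sum_hCross_of_count_eq_one {a b : Site 2} (p : (zdGraph 2).Walk a b) (u : Site 2)
    (h : p.edges.count s(u + Pi.single 1 1, u + Pi.single 1 1 + Pi.single 0 1) = 1) :
    (p.darts.map fun d => hCross u d.fst d.snd).sum = 1 ∨
      (p.darts.map fun d => hCross u d.fst d.snd).sum = -1 := by
  classical
  set eh : Sym2 (Site 2) := s(u + Pi.single 1 1, u + Pi.single 1 1 + Pi.single 0 1) with heh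
  have hc : p.darts.countP (fun d => decide (d.edge = eh)) = 1 := by rw [countP_darts_edge_eq, h]
  refine sum_map_eq_one_or_of_countP p.darts (fun d => hCross u d.fst d.snd) (fun d => d.edge = eh)
    (fun d _ hd => hCross_eq_zero_of_ne fun heq => hd (by rw [heh, ← heq]; rfl)) (fun d _ hd => ?_) hc
  have hd' : s(d.fst, d.snd) = eh := hd
  rw [heh, Sym2.eq_iff] at hd'
  unfold hCross
  rcases hd' with ⟨h1, h2⟩ | ⟨h1, h2⟩
  · left
    rw [h1, h2]
    simp
  · right
    rw [h1, h2]
    simp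

/-- **Unused edge: equal winding on its two faces** (closed walks): if the closed lattice walk `C`
does not use `vxEdge v k`, it winds equally around `vxFace v (k-1)` and `vxFace v k`. [folklore] -/
theorem walkWinding_vxFace_eq_of_notMem {c : Site 2} (C : (zdGraph 2).Walk c c) (k : Fin 4)
    (h : vxEdge v k ∉ C.edges) :
    walkWinding C (vxFace v (k - 1)) = walkWinding C (vxFace v k) :=
  walkWinding_closed_eq_of_adj (adj_vxFace k) (by rwa [sepEdge_vxFace])

/-- **Edge used once: different winding on its two faces** (closed walks): if the closed lattice
walk `C` uses `vxEdge v k` exactly once, its winding numbers around `vxFace v (k-1)` and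
`vxFace v k` differ (by `±1`). [folklore] -/
theorem walkWinding_vxFace_ne_of_count {c : Site 2} (C : (zdGraph 2).Walk c c) (k : Fin 4)
    (h : C.edges.count (vxEdge v k) = 1) :
    walkWinding C (vxFace v (k - 1)) ≠ walkWinding C (vxFace v k) := by
  fin_cases k
  · -- the horizontal edge `{v, v + e₀}` between SE (below) and NE (above)
    have key := walkWinding_sub_walkWinding_up_closed C (v - Pi.single 1 1)
    simp only [sub_add_cancel] at key
    have hs := sum_hCross_of_count_eq_one C (v - Pi.single 1 1) (by simpa using h)
    show walkWinding C (v - Pi.single 1 1) ≠ walkWinding C v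
    intro heq
    rw [heq, sub_self] at key
    rcases hs with hs | hs <;> rw [hs] at key <;> norm_num at key
  · -- the vertical edge `{v, v + e₁}` between NE (right) and NW (left)
    have key := walkWinding_sub_walkWinding_right C (v - Pi.single 0 1)
    simp only [sub_add_cancel] at key
    have hs := sum_vCross_of_count_eq_one C (v - Pi.single 0 1) (by simpa using h)
    show walkWinding C v ≠ walkWinding C (v - Pi.single 0 1)
    intro heq
    rw [← heq, sub_self] at key
    rcases hs with hs | hs <;> rw [hs] at key <;> norm_num at key
  · -- the horizontal edge `{v - e₀, v}` between SW (below) and NW (above)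
    have key := walkWinding_sub_walkWinding_up_closed C (v - Pi.single 0 1 - Pi.single 1 1)
    have e1 : v - Pi.single 0 1 - Pi.single 1 1 + Pi.single 1 1 = v - Pi.single 0 1 := by simp
    have e2 : v - Pi.single 0 1 + Pi.single 0 1 = v := by simp
    rw [e1] at key
    have hs := sum_hCross_of_count_eq_one C (v - Pi.single 0 1 - Pi.single 1 1)
      (by rw [e1, e2]; simpa using h)
    show walkWinding C (v - Pi.single 0 1) ≠ walkWinding C (v - Pi.single 0 1 - Pi.single 1 1)
    intro heq
    rw [← heq, sub_self] at key
    rcases hs with hs | hs <;> rw [hs] at key <;> norm_num at key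
  · -- the vertical edge `{v - e₁, v}` between SW (left) and SE (right)
    have key := walkWinding_sub_walkWinding_right C (v - Pi.single 0 1 - Pi.single 1 1)
    have e1 : v - Pi.single 0 1 - Pi.single 1 1 + Pi.single 0 1 = v - Pi.single 1 1 := by
      ext i; fin_cases i <;> simp
    have e2 : v - Pi.single 1 1 + Pi.single 1 1 = v := by simp
    rw [e1] at key
    have hs := sum_vCross_of_count_eq_one C (v - Pi.single 0 1 - Pi.single 1 1)
      (by rw [e1, e2]; simpa using h)
    show walkWinding C (v - Pi.single 0 1 - Pi.single 1 1) ≠ walkWinding C (v - Pi.single 1 1)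
    intro heq
    rw [heq, sub_self] at key
    rcases hs with hs | hs <;> rw [hs] at key <;> norm_num at key

/-- **Unused edge: equal winding on its two faces** (general walks, with the half-line
conditions at the endpoints). [folklore] -/
theorem walkWinding_vxFace_eq_of_notMem' {a b : Site 2} (p : (zdGraph 2).Walk a b) (k : Fin 4)
    (h : vxEdge v k ∉ p.edges) (ha : ∀ k, a ∉ rayAbove (vxFace v k)) (hb : ∀ k, b ∉ rayAbove (vxFace v k)) :
    walkWinding p (vxFace v (k - 1)) = walkWinding p (vxFace v k) := by
  refine walkWinding_eq_of_faceWalk p (Walk.cons (adj_vxFace k) Walk.nil) ?_ ?_ ?_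
  · intro dq hdq
    simp only [Walk.darts_cons, Walk.darts_nil, List.mem_cons, List.not_mem_nil, or_false] at hdq
    subst hdq
    show sepEdge (vxFace v (k - 1)) (vxFace v k) ∉ p.edges
    rwa [sepEdge_vxFace]
  · intro z hz
    simp only [Walk.support_cons, Walk.support_nil, List.mem_cons, List.not_mem_nil, or_false] at hz
    rcases hz with rfl | rfl <;> exact ha _
  · intro z hz
    simp only [Walk.support_cons, Walk.support_nil, List.mem_cons, List.not_mem_nil, or_false] at hz
    rcases hz with rfl | rfl <;> exact hb _

end WindingAround

/-! ### Prefixes of walks and trimming of arms to a translated annulus -/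

section Trim

variable {V : Type*} {G : SimpleGraph V}

/-- **Prefix up to the first exit, with the decomposition.** A walk from a vertex of `A` to a vertex
outside `A` splits as `q₁ ++ (x → w) ++ q₂` with `q₁ ⊆ A` and `w ∉ A`. [folklore] -/
theorem exists_prefix_exit_eq {A : Set V} {s t : V} (q : G.Walk s t) (hs : s ∈ A) (ht : t ∉ A) :
    ∃ (x w : V) (q₁ : G.Walk s x) (hxw : G.Adj x w) (q₂ : G.Walk w t),
      (∀ u ∈ q₁.support, u ∈ A) ∧ w ∉ A ∧ q = q₁.append (Walk.cons hxw q₂) := by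
  induction q with
  | nil => exact absurd hs ht
  | @cons u v w h q' ih =>
    by_cases hv : v ∈ A
    · obtain ⟨x, w', q₁, hxw, q₂, hA, hw', rfl⟩ := ih hv ht
      refine ⟨x, w', Walk.cons h q₁, hxw, q₂, ?_, hw', rfl⟩
      intro z hz
      rw [Walk.support_cons, List.mem_cons] at hz
      rcases hz with rfl | hz
      · exact hs
      · exact hA z hz
    · exact ⟨u, v, Walk.nil, h, q', by simpa using hs, hv, rfl⟩

/-- The support of a prefix is a sublist of the support. [folklore] -/
theorem support_sublist_of_append_eq {a b c : V} (p : G.Walk a b) (q : G.Walk b c) :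
    p.support.Sublist (p.append q).support := by
  rw [Walk.support_append]
  exact List.sublist_append_left _ _

variable {z : Site 2}

/-- A neighbour of a site of `z + Λ_k` lies in `z + Λ_{k+1}`. [folklore] -/
theorem sub_mem_box_succ_of_adj' {x y : Site 2} {k : ℕ} (hx : x - z ∈ box 2 k) (h : (zdGraph 2).Adj x y) :
    y - z ∈ box 2 (k + 1) :=
  ZdPivotal.sub_mem_box_succ_of_adj hx h

/-- **Trimming an arm.** Let `Q` be a lattice walk from `v` with `‖v - z‖_∞ ≤ m - 1` visiting a site
outside `z + Λ_{n-1}` (`1 ≤ m ≤ n`). Then an initial segment of `Q` splits as `A ++ W` where `A` runs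
from `v` to a site `x₁` with `‖x₁ - z‖_∞ = m` inside `z + Λ_n`, and `W` runs from `x₁` inside the
annulus `z + A_{m,n}` to a site `y₁` with `‖y₁ - z‖_∞ = n`. [folklore] -/
theorem exists_arm_trim {v y : Site 2} {m n : ℕ} (hm : 1 ≤ m) (hmn : m ≤ n) (Q : (zdGraph 2).Walk v y)
    (hv : v - z ∈ box 2 (m - 1)) (hfar : ∃ x ∈ Q.support, x - z ∉ box 2 (n - 1)) :
    ∃ (x₁ y₁ : Site 2) (A : (zdGraph 2).Walk v x₁) (W : (zdGraph 2).Walk x₁ y₁),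
      x₁ - z ∈ siteSphere m ∧ y₁ - z ∈ siteSphere n ∧
      (∀ x ∈ A.support, x - z ∈ box 2 n) ∧ (∀ x ∈ W.support, x - z ∈ sqAnnulus m n) ∧
      (A.append W).support.Sublist Q.support ∧ ∀ e ∈ (A.append W).edges, e ∈ Q.edges := by
  classical
  -- Step 1: the prefix `Q₁` up to the first exit from `z + Λ_{n-1}`
  have hvA : v ∈ ({u | u - z ∈ box 2 (n - 1)} : Set (Site 2)) := box_mono 2 (by omega) hv
  obtain ⟨xf, hxf, hxfn⟩ := hfar
  set Qa := Q.takeUntil xf hxf with hQa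
  obtain ⟨x, y₁, q₁, hxy, q₂, hq₁A, hy₁A, hdec⟩ :=
    exists_prefix_exit_eq (A := {u | u - z ∈ box 2 (n - 1)}) Qa hvA hxfn
  have hy₁n : y₁ - z ∈ box 2 n := by
    have := sub_mem_box_succ_of_adj' (hq₁A x q₁.end_mem_support) hxy
    rwa [Nat.sub_add_cancel (hm.trans hmn)] at this
  have hy₁s : y₁ - z ∈ siteSphere n := Finset.mem_sdiff.2 ⟨hy₁n, hy₁A⟩
  set Q₁ : (zdGraph 2).Walk v y₁ := q₁.concat hxy with hQ₁
  have hQ₁box : ∀ u ∈ Q₁.support, u - z ∈ box 2 n := by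
    intro u hu
    rw [hQ₁, Walk.support_concat, List.mem_append, List.mem_singleton] at hu
    rcases hu with hu | rfl
    · exact box_mono 2 (Nat.sub_le n 1) (hq₁A u hu)
    · exact hy₁n
  have hQ₁sub : Q₁.support.Sublist Q.support := by
    have h1 : Q₁.support.Sublist Qa.support := by
      rw [hQ₁, Walk.support_concat, hdec, Walk.support_append, Walk.support_cons, List.tail_cons]
      exact (List.Sublist.refl _).append (List.singleton_sublist.2 q₂.start_mem_support)
    have h2 : Qa.support.Sublist Q.support := by
      conv_rhs => rw [← Walk.take_spec Q hxf]
      rw [hQa]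
      exact support_sublist_of_append_eq _ _
    exact h1.trans h2
  have hQ₁edges : ∀ e ∈ Q₁.edges, e ∈ Q.edges := by
    intro e he
    rw [hQ₁, Walk.edges_concat, List.concat_eq_append, List.mem_append, List.mem_singleton] at he
    apply Q.edges_takeUntil_subset_edges hxf
    rw [← hQa, hdec, Walk.edges_append, Walk.edges_cons]
    rcases he with he | rfl
    · exact List.mem_append_left _ he
    · exact List.mem_append_right _ List.mem_cons_self
  -- Step 2: inside `Q₁.reverse`, the prefix up to the first entrance into `z + Λ_{m-1}`
  have hy₁B : y₁ ∈ ({u | u - z ∉ box 2 (m - 1)} : Set (Site 2)) := fun h' =>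
    hy₁A (box_mono 2 (by omega) h')
  have hvB : v ∉ ({u | u - z ∉ box 2 (m - 1)} : Set (Site 2)) := fun h' => h' hv
  obtain ⟨x₁, x', r₁, hx₁x', r₂, hr₁B, hx'B, hdec'⟩ :=
    exists_prefix_exit_eq (A := {u | u - z ∉ box 2 (m - 1)}) Q₁.reverse hy₁B hvB
  have hx'box : x' - z ∈ box 2 (m - 1) := not_not.1 hx'B
  have hx₁m : x₁ - z ∈ box 2 m := by
    have := sub_mem_box_succ_of_adj' hx'box hx₁x'.symm
    rwa [Nat.sub_add_cancel hm] at this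
  have hx₁s : x₁ - z ∈ siteSphere m := Finset.mem_sdiff.2 ⟨hx₁m, hr₁B x₁ r₁.end_mem_support⟩
  -- the pieces
  set A : (zdGraph 2).Walk v x₁ := (Walk.cons hx₁x' r₂).reverse with hA
  set W : (zdGraph 2).Walk x₁ y₁ := r₁.reverse with hW
  have hAW : Q₁ = A.append W := by
    have : Q₁ = Q₁.reverse.reverse := (Walk.reverse_reverse _).symm
    rw [this, hdec', Walk.reverse_append]
  refine ⟨x₁, y₁, A, W, hx₁s, hy₁s, ?_, ?_, hAW ▸ hQ₁sub, fun e he => hQ₁edges e (hAW ▸ he)⟩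
  · intro u hu
    apply hQ₁box
    rw [hAW, Walk.support_append]
    exact List.mem_append_left _ hu
  · intro u hu
    rw [hW, Walk.support_reverse, List.mem_reverse] at hu
    have hun : u - z ∈ box 2 n := by
      apply hQ₁box
      have : u ∈ Q₁.reverse.support := by
        rw [hdec', Walk.support_append]
        exact List.mem_append_left _ hu
      rwa [Walk.support_reverse, List.mem_reverse] at this
    simp only [sqAnnulus, Finset.mem_coe, mem_annulus]
    exact ⟨hun, hr₁B u hu⟩

end Trim

/-! ### Small walk facts -/

section WalkFacts

variable {V : Type*} {G : SimpleGraph V}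

/-- In a walk from `v` visiting `v` only once, an edge at `v` is the first edge; in particular two
edges of the walk at `v` coincide. [folklore] -/
theorem eq_of_mem_edges_of_count_le_one [DecidableEq V] {v x : V} (A : G.Walk v x) (hc : A.support.count v ≤ 1)
    {e e' : Sym2 V} (he : e ∈ A.edges) (hve : v ∈ e) (he' : e' ∈ A.edges) (hve' : v ∈ e') : e = e' := by
  cases A with
  | nil => simp at he
  | cons h A' =>
    rename_i w
    have hvA' : v ∉ A'.support := by
      intro hv
      rw [Walk.support_cons, List.count_cons_self] at hc
      have := List.count_pos_iff.2 hv
      omega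
    have key : ∀ f ∈ (Walk.cons h A').edges, v ∈ f → f = s(v, w) := by
      intro f hf hvf
      rw [Walk.edges_cons, List.mem_cons] at hf
      rcases hf with rfl | hf
      · rfl
      · exact absurd (mem_support_of_mem_edges_of_mem A' hf hvf) hvA'
    rw [key e he hve, key e' he' hve']

/-- In a walk from `v` visiting `v` only once, an edge at `v` is used exactly once. [folklore] -/
theorem count_edges_eq_one_of_count_le_one [DecidableEq V] {v x : V} (A : G.Walk v x) (hc : A.support.count v ≤ 1)
    {e : Sym2 V} (he : e ∈ A.edges) (hve : v ∈ e) : A.edges.count e = 1 := by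
  cases A with
  | nil => simp at he
  | cons h A' =>
    rename_i w
    have hvA' : v ∉ A'.support := by
      intro hv
      rw [Walk.support_cons, List.count_cons_self] at hc
      have := List.count_pos_iff.2 hv
      omega
    have heA' : ∀ f ∈ A'.edges, v ∉ f := fun f hf hvf =>
      hvA' (mem_support_of_mem_edges_of_mem A' hf hvf)
    rw [Walk.edges_cons, List.mem_cons] at he
    rcases he with rfl | he
    · rw [Walk.edges_cons, List.count_cons_self, List.count_eq_zero.2 (fun h' => heA' _ h' hve)]
    · exact absurd hve (heA' e he)

/-- A walk between distinct vertices has an edge at its start. [folklore] -/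
theorem exists_mem_edges_start {v x : V} (A : G.Walk v x) (hx : x ≠ v) : ∃ e ∈ A.edges, v ∈ e := by
  cases A with
  | nil => exact absurd rfl hx
  | cons h A' => exact ⟨_, List.mem_cons_self, Sym2.mem_mk_left _ _⟩

/-- Edges of vertex-disjoint walks are distinct. [folklore] -/
theorem edges_disjoint_of_support {a b c d : V} (p : G.Walk a b) (q : G.Walk c d)
    (h : ∀ x ∈ p.support, x ∉ q.support) : ∀ e ∈ p.edges, e ∉ q.edges := by
  intro e hep heq
  induction e using Sym2.ind with
  | h x y => exact h x (p.fst_mem_support_of_mem_edges hep) (q.fst_mem_support_of_mem_edges heq)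

end WalkFacts

/-! ### The five-arm event from five arms at a vertex of the lowest crossing -/

section Core

variable {ω : BondConfig (Site 2)} {j : ℕ} {a b : Site 2} {π : (zdGraph 2).Walk a b}

/-- **The deterministic core, abstract local form.**  Data: the lowest crossing `π` (a path of boundary
edges of `D₀ = dualBelow j ω`), an interior vertex `v` of `π`, an open landing edge `{v, t}` with
`t ∉ π` and an open walk `P` from `t` avoiding `π` (the arm to the top), a walk of faces `Δ` from a
face `h₁` crossing only closed edges (the dual arm), an edge `eγ ≠ {v, t}` of `π` at `v` with a
face `g ∈ D₀` (the `D₀`-arm starts there), and the LOCAL SEPARATION PROPERTY: every closed lattice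
walk through `v` using exactly `{v, t}` and `eγ` there winds differently around `h₁` and `g`.  If
around the centre `z` (`‖v - z‖_∞ ≤ m - 1`) the walks `P`, `π[a, v]`, `π[v, b]` leave `z + Λ_{n-1}`,
`Δ` ends at height `≥ z₁ + n` and `z₁ - n ≥ 1`, then `ω - z ∈ zdFiveArmClusters m n`.
[cite: Nolin2008, §5.2, proof of Thm. 24 (ii) (arXiv 0711.4948: Thm. 23 (ii))] -/
theorem relabel_shift_mem_zdFiveArmClusters_of_local (hω : ω ⊆ (zdGraph 2).edgeSet)
    (hpath : π.IsPath) (hbdry : ∀ d ∈ π.darts, IsBdryEdge (dualBelow j ω) j d.edge)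
    {v t : Site 2} (hv : v ∈ π.support) (hvt : (zdGraph 2).Adj v t)
    (hvtω : s(v, t) ∈ ω) {s : Site 2} (P : (zdGraph 2).Walk t s) (hPπ : ∀ x ∈ P.support, x ∉ π.support)
    (hPω : ∀ e ∈ P.edges, e ∈ ω) {h₁ f₀ : Site 2} (Δ : (zdGraph 2).Walk h₁ f₀)
    (hΔ : ∀ d ∈ Δ.darts, sepEdge d.fst d.snd ∉ ω)
    {eγ : Sym2 (Site 2)} (heγ : eγ ∈ π.edges) (hveγ : v ∈ eγ) (heγt : eγ ≠ s(v, t))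
    {g : Site 2} (hg : g ∈ dualBelow j ω)
    (hloc : ∀ (C : (zdGraph 2).Walk v v), C.edges.count s(v, t) = 1 → C.edges.count eγ = 1 →
      (∀ e ∈ C.edges, v ∈ e → e = s(v, t) ∨ e = eγ) → walkWinding C h₁ ≠ walkWinding C g)
    (z : Site 2) {m n : ℕ} (hm : 1 ≤ m) (hmn : m ≤ n) (hvz : v - z ∈ box 2 (m - 1))
    (hf₀ : z 1 + n ≤ f₀ 1) (hzn : 1 ≤ z 1 - n)
    (hPfar : ∃ x ∈ P.support, x - z ∉ box 2 (n - 1))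
    (hLfar : ∃ x ∈ (π.takeUntil v hv).support, x - z ∉ box 2 (n - 1))
    (hRfar : ∃ x ∈ (π.dropUntil v hv).support, x - z ∉ box 2 (n - 1)) :
    BondConfig.relabel (sym2Equiv (Site.shift (-z))) ω ∈ zdFiveArmClusters m n := by
  classical
  set D₀ := dualBelow j ω with hD₀
  have hπω : ∀ e ∈ π.edges, e ∈ ω := by
    intro e he
    rw [Walk.edges, List.mem_map] at he
    obtain ⟨d, hd, rfl⟩ := he
    exact mem_of_isBdryEdge rfl d.edge_mem (hbdry d hd)
  have hvP : v ∉ P.support := fun h' => hPπ v h' hv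
  -- the two pieces of `π` at `v`, oriented away from `v`
  set πL : (zdGraph 2).Walk v a := (π.takeUntil v hv).reverse with hπL
  set πR : (zdGraph 2).Walk v b := π.dropUntil v hv with hπR
  have hπLpath : πL.IsPath := (hpath.takeUntil hv).reverse
  have hπRpath : πR.IsPath := hpath.dropUntil hv
  have hπLsub : ∀ x ∈ πL.support, x ∈ π.support := fun x hx => by
    rw [hπL, Walk.support_reverse, List.mem_reverse] at hx
    exact π.support_takeUntil_subset_support hv hx
  have hπRsub : ∀ x ∈ πR.support, x ∈ π.support := fun x hx => π.support_dropUntil_subset_support hv hx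
  have hπLedges : ∀ e ∈ πL.edges, e ∈ π.edges := fun e he => by
    rw [hπL, Walk.edges_reverse, List.mem_reverse] at he
    exact π.edges_takeUntil_subset_edges hv he
  have hπRedges : ∀ e ∈ πR.edges, e ∈ π.edges := fun e he => π.edges_dropUntil_subset_edges hv he
  -- the two pieces meet only at `v`
  have hLR : ∀ x ∈ πL.support, x ∈ πR.support → x = v := by
    intro x hxL hxR
    have hnd : (π.takeUntil v hv).support ++ (π.dropUntil v hv).support.tail = π.support := by
      rw [← Walk.support_append, Walk.take_spec]
    have hnodup : ((π.takeUntil v hv).support ++ (π.dropUntil v hv).support.tail).Nodup := by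
      rw [hnd]; exact hpath.support_nodup
    rw [hπL, Walk.support_reverse, List.mem_reverse] at hxL
    rw [hπR] at hxR
    by_contra hne
    have hxtail : x ∈ (π.dropUntil v hv).support.tail :=
      ((Walk.mem_support_iff _).1 hxR).resolve_left hne
    exact (List.disjoint_of_nodup_append hnodup) hxL hxtail
  -- choose the piece `Qγ` carrying `eγ` and the other piece `Q3`
  obtain ⟨bγ, b3, Qγ, Q3, heγQ, hQγpath, hQ3path, hQγsub, hQ3sub, hQγedges, hQ3edges, hγ3, hQγfar, hQ3far⟩ :
      ∃ (bγ b3 : Site 2) (Qγ : (zdGraph 2).Walk v bγ) (Q3 : (zdGraph 2).Walk v b3),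
        eγ ∈ Qγ.edges ∧ Qγ.IsPath ∧ Q3.IsPath ∧ (∀ x ∈ Qγ.support, x ∈ π.support) ∧
        (∀ x ∈ Q3.support, x ∈ π.support) ∧ (∀ e ∈ Qγ.edges, e ∈ π.edges) ∧ (∀ e ∈ Q3.edges, e ∈ π.edges) ∧
        (∀ x ∈ Qγ.support, x ∈ Q3.support → x = v) ∧
        (∃ x ∈ Qγ.support, x - z ∉ box 2 (n - 1)) ∧ (∃ x ∈ Q3.support, x - z ∉ box 2 (n - 1)) := by
    have heγ' : eγ ∈ πL.edges ∨ eγ ∈ πR.edges := by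
      have : eγ ∈ (π.takeUntil v hv).edges ++ (π.dropUntil v hv).edges := by
        rw [← Walk.edges_append, Walk.take_spec]; exact heγ
      rcases List.mem_append.1 this with h' | h'
      · left; rw [hπL, Walk.edges_reverse, List.mem_reverse]; exact h'
      · right; exact h'
    have hLfar' : ∃ x ∈ πL.support, x - z ∉ box 2 (n - 1) := by
      obtain ⟨x, hx, hxn⟩ := hLfar
      exact ⟨x, by rw [hπL, Walk.support_reverse, List.mem_reverse]; exact hx, hxn⟩
    rcases heγ' with h' | h'
    · exact ⟨a, b, πL, πR, h', hπLpath, hπRpath, hπLsub, hπRsub, hπLedges, hπRedges, hLR, hLfar', hRfar⟩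
    · exact ⟨b, a, πR, πL, h', hπRpath, hπLpath, hπRsub, hπLsub, hπRedges, hπLedges,
        fun x hxR hxL => hLR x hxL hxR, hRfar, hLfar'⟩
  -- trim the three open arms
  obtain ⟨x₁, y₁, A₁, W₁, hx₁, hy₁, hA₁box, hW₁ann, hAW₁sub, hAW₁edges⟩ :=
    exists_arm_trim (z := z) hm hmn (Walk.cons hvt P) hvz
      (let ⟨x, hx, hxn⟩ := hPfar; ⟨x, List.mem_cons_of_mem _ hx, hxn⟩)
  obtain ⟨x₂, y₂, A₂, W₂, hx₂, hy₂, hA₂box, hW₂ann, hAW₂sub, hAW₂edges⟩ :=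
    exists_arm_trim (z := z) hm hmn Qγ hvz hQγfar
  obtain ⟨x₃, y₃, A₃, W₃, hx₃, hy₃, -, hW₃ann, hAW₃sub, hAW₃edges⟩ :=
    exists_arm_trim (z := z) hm hmn Q3 hvz hQ3far
  -- `v` is not in the annulus
  have hvann : v - z ∉ sqAnnulus m n := by
    simp only [sqAnnulus, Finset.mem_coe, mem_annulus, not_and, not_not]
    exact fun _ => hvz
  have hvW₁ : v ∉ W₁.support := fun h' => hvann (hW₁ann v h')
  have hvW₂ : v ∉ W₂.support := fun h' => hvann (hW₂ann v h')
  have hvW₃ : v ∉ W₃.support := fun h' => hvann (hW₃ann v h')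
  -- supports and edges of the trimmed pieces inside their sources
  have hW₁P : ∀ x ∈ W₁.support, x ∈ P.support := by
    intro x hx
    have h1 : x ∈ (Walk.cons hvt P).support :=
      hAW₁sub.subset ((Walk.mem_support_append_iff _ _).2 (Or.inr hx))
    rw [Walk.support_cons, List.mem_cons] at h1
    rcases h1 with rfl | h1
    · exact absurd hx hvW₁
    · exact h1
  have hW₂Q : ∀ x ∈ W₂.support, x ∈ Qγ.support := fun x hx =>
    hAW₂sub.subset ((Walk.mem_support_append_iff _ _).2 (Or.inr hx))
  have hW₃Q : ∀ x ∈ W₃.support, x ∈ Q3.support := fun x hx =>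
    hAW₃sub.subset ((Walk.mem_support_append_iff _ _).2 (Or.inr hx))
  have hA₁sup : ∀ x ∈ A₁.support, x ∈ (Walk.cons hvt P).support := fun x hx =>
    hAW₁sub.subset ((Walk.mem_support_append_iff _ _).2 (Or.inl hx))
  have hA₂Q : ∀ x ∈ A₂.support, x ∈ Qγ.support := fun x hx =>
    hAW₂sub.subset ((Walk.mem_support_append_iff _ _).2 (Or.inl hx))
  have hA₁edges : ∀ e ∈ A₁.edges, e ∈ (Walk.cons hvt P).edges := fun e he =>
    hAW₁edges e (by rw [Walk.edges_append]; exact List.mem_append_left _ he)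
  have hW₁edges : ∀ e ∈ W₁.edges, e ∈ (Walk.cons hvt P).edges := fun e he =>
    hAW₁edges e (by rw [Walk.edges_append]; exact List.mem_append_right _ he)
  have hA₂edges : ∀ e ∈ A₂.edges, e ∈ Qγ.edges := fun e he =>
    hAW₂edges e (by rw [Walk.edges_append]; exact List.mem_append_left _ he)
  have hW₂edges : ∀ e ∈ W₂.edges, e ∈ Qγ.edges := fun e he =>
    hAW₂edges e (by rw [Walk.edges_append]; exact List.mem_append_right _ he)
  have hW₃edges : ∀ e ∈ W₃.edges, e ∈ Q3.edges := fun e he =>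
    hAW₃edges e (by rw [Walk.edges_append]; exact List.mem_append_right _ he)
  have hvtPω : ∀ e ∈ (Walk.cons hvt P).edges, e ∈ ω := by
    intro e he
    rw [Walk.edges_cons, List.mem_cons] at he
    rcases he with rfl | he
    · exact hvtω
    · exact hPω e he
  -- openness of the three arms
  have hW₁ω : ∀ e ∈ W₁.edges, e ∈ ω := fun e he => hvtPω e (hW₁edges e he)
  have hW₂ω : ∀ e ∈ W₂.edges, e ∈ ω := fun e he => hπω e (hQγedges e (hW₂edges e he))
  have hW₃ω : ∀ e ∈ W₃.edges, e ∈ ω := fun e he => hπω e (hQ3edges e (hW₃edges e he))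
  -- edge-disjointness
  have hd₁₃ : ∀ e ∈ W₁.edges, e ∉ W₃.edges :=
    edges_disjoint_of_support W₁ W₃ fun x hx hx3 => hPπ x (hW₁P x hx) (hQ3sub x (hW₃Q x hx3))
  have hd₂₃ : ∀ e ∈ W₂.edges, e ∉ W₃.edges :=
    edges_disjoint_of_support W₂ W₃ fun x hx hx3 => hvW₂ (hγ3 x (hW₂Q x hx) (hW₃Q x hx3) ▸ hx)
  -- counting at `v`
  have hcvtP : (Walk.cons hvt P).support.count v = 1 := by
    rw [Walk.support_cons, List.count_cons_self, List.count_eq_zero.2 hvP]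
  have hcA₁ : A₁.support.count v ≤ 1 := by
    have h1 : A₁.support.Sublist (A₁.append W₁).support := support_sublist_of_append_eq _ _
    exact ((h1.trans hAW₁sub).count_le v).trans hcvtP.le
  have hcQγ : Qγ.support.count v ≤ 1 := List.nodup_iff_count_le_one.1 hQγpath.support_nodup v
  have hcA₂ : A₂.support.count v ≤ 1 := by
    have h1 : A₂.support.Sublist (A₂.append W₂).support := support_sublist_of_append_eq _ _
    exact ((h1.trans hAW₂sub).count_le v).trans hcQγ
  have heA₁ : ∀ e ∈ A₁.edges, v ∈ e → e = s(v, t) := by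
    intro e he hve
    have h1 := hA₁edges e he
    rw [Walk.edges_cons, List.mem_cons] at h1
    rcases h1 with rfl | h1
    · rfl
    · exact absurd (mem_support_of_mem_edges_of_mem P h1 hve) hvP
  have heQγ : ∀ e ∈ Qγ.edges, v ∈ e → e = eγ := fun e he hve =>
    eq_of_mem_edges_of_count_le_one Qγ hcQγ he hve heγQ hveγ
  have heA₂ : ∀ e ∈ A₂.edges, v ∈ e → e = eγ := fun e he hve => heQγ e (hA₂edges e he) hve
  have hx₁v : x₁ ≠ v := by
    rintro rfl
    exact (Finset.mem_sdiff.1 hx₁).2 hvz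
  have hx₂v : x₂ ≠ v := by
    rintro rfl
    exact (Finset.mem_sdiff.1 hx₂).2 hvz
  have hvtA₁ : s(v, t) ∈ A₁.edges := by
    obtain ⟨e, he, hve⟩ := exists_mem_edges_start A₁ hx₁v
    rwa [heA₁ e he hve] at he
  have heγA₂ : eγ ∈ A₂.edges := by
    obtain ⟨e, he, hve⟩ := exists_mem_edges_start A₂ hx₂v
    rwa [heA₂ e he hve] at he
  -- coordinates along the inner pieces
  have hbox1 : ∀ {w : Site 2}, w - z ∈ box 2 n → z 1 - n ≤ w 1 ∧ w 1 ≤ z 1 + n := by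
    intro w hw
    have := (mem_box.1 hw) 1
    simp only [Pi.sub_apply] at this
    omega
  have hann_box : ∀ {w : Site 2}, w - z ∈ sqAnnulus m n → w - z ∈ box 2 n := by
    intro w hw
    simp only [sqAnnulus, Finset.mem_coe, mem_annulus] at hw
    exact hw.1
  -- the translated witnesses
  set φ := (zdShiftIso (-z)).toHom with hφ
  have hsph : ∀ {x : Site 2} {k : ℕ}, x - z ∈ siteSphere k → x + -z ∈ siteSphere k := by
    intro x k hx; simpa [sub_eq_add_neg] using hx
  have hsupp : ∀ {c d : Site 2} (W : (zdGraph 2).Walk c d), (∀ x ∈ W.support, x - z ∈ sqAnnulus m n) →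
      ∀ w ∈ (W.map φ).support, w ∈ sqAnnulus m n := by
    intro c d W hW w hw
    rw [hφ, mem_support_map_shift] at hw
    have := hW _ hw
    simpa using this
  have hedge : ∀ {c d : Site 2} (W : (zdGraph 2).Walk c d), (∀ e ∈ W.edges, e ∈ ω) →
      ∀ e ∈ (W.map φ).edges, e ∈ BondConfig.relabel (sym2Equiv (Site.shift (-z))) ω := by
    intro c d W hW e he
    obtain ⟨e', he', rfl⟩ := mem_edges_map_shift (v := -z) (by rw [hφ] at he; exact he)
    exact (map_add_mem_relabel_shift_iff (-z) ω e').2 (hW e' he')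
  have hdisj : ∀ {c d c' d' : Site 2} (W : (zdGraph 2).Walk c d) (W' : (zdGraph 2).Walk c' d'),
      (∀ e ∈ W.edges, e ∉ W'.edges) → ∀ e ∈ (W.map φ).edges, e ∉ (W'.map φ).edges := by
    intro c d c' d' W W' hWW' e he he'
    obtain ⟨e₁, he₁, rfl⟩ := mem_edges_map_shift (v := -z) (by rw [hφ] at he; exact he)
    obtain ⟨e₂, he₂, heq⟩ := mem_edges_map_shift (v := -z) (by rw [hφ] at he'; exact he')
    have : e₁ = e₂ := Sym2.map.injective (add_left_injective (-z)) heq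
    exact hWW' e₁ he₁ (this ▸ he₂)
  refine ⟨x₁ + -z, x₂ + -z, x₃ + -z, y₁ + -z, y₂ + -z, y₃ + -z, W₁.map φ, W₂.map φ, W₃.map φ,
    hsph hx₁, hsph hx₂, hsph hx₃, hsph hy₁, hsph hy₂, hsph hy₃, hsupp W₁ hW₁ann, hsupp W₂ hW₂ann,
    hsupp W₃ hW₃ann, hedge W₁ hW₁ω, hedge W₂ hW₂ω, hedge W₃ hW₃ω, hdisj W₁ W₃ hd₁₃, hdisj W₂ W₃ hd₂₃,
    fun hconn => ?_⟩
  -- ### the separation: a connection inside the annulus closes up to a contradiction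
  obtain ⟨ρ', hρ's, hρ'e⟩ := exists_walk_of_mem_openConnIn (relabel_shift_subset_edgeSet (-z) hω) hconn
  set ρ : (zdGraph 2).Walk x₁ x₂ := (ρ'.map (zdShiftIso z).toHom).copy (by simp) (by simp) with hρ
  have hρsupp : ∀ u ∈ ρ.support, u - z ∈ sqAnnulus m n := by
    intro u hu
    rw [hρ, Walk.support_copy, mem_support_map_shift] at hu
    exact hρ's _ hu
  have hρω : ∀ e ∈ ρ.edges, e ∈ ω := by
    intro e he
    rw [hρ, Walk.edges_copy] at he
    obtain ⟨e', he', rfl⟩ := mem_edges_map_shift he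
    have h1 := hρ'e e' he'
    have h2 := map_add_mem_relabel_shift_iff (-z) ω (Sym2.map (· + z) e')
    rw [Sym2.map_map] at h2
    have h3 : ((fun x : Site 2 => x + -z) ∘ fun x => x + z) = id := by funext x; simp
    rw [h3, Sym2.map_id, id] at h2
    exact h2.1 h1
  have hvρ : v ∉ ρ.support := fun h' => hvann (hρsupp v h')
  set C : (zdGraph 2).Walk v v := (A₁.append ρ).append A₂.reverse with hC
  have hCedges : ∀ e, e ∈ C.edges ↔ e ∈ A₁.edges ∨ e ∈ ρ.edges ∨ e ∈ A₂.edges := by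
    intro e
    rw [hC, Walk.edges_append, Walk.edges_append, Walk.edges_reverse, List.mem_append, List.mem_append,
      List.mem_reverse, or_assoc]
  have hCω : ∀ e ∈ C.edges, e ∈ ω := by
    intro e he
    rcases (hCedges e).1 he with he | he | he
    · exact hvtPω e (hA₁edges e he)
    · exact hρω e he
    · exact hπω e (hQγedges e (hA₂edges e he))
  have hCsupp : ∀ w ∈ C.support, z 1 - n ≤ w 1 ∧ w 1 ≤ z 1 + n := by
    intro w hw
    rw [hC, Walk.mem_support_append_iff, Walk.mem_support_append_iff, Walk.support_reverse,
      List.mem_reverse] at hw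
    rcases hw with (hw | hw) | hw
    · exact hbox1 (hA₁box w hw)
    · exact hbox1 (hann_box (hρsupp w hw))
    · exact hbox1 (hA₂box w hw)
  -- edge counts at `v`
  have hcount : ∀ e, C.edges.count e = A₁.edges.count e + ρ.edges.count e + A₂.edges.count e := by
    intro e
    rw [hC, Walk.edges_append, Walk.edges_append, Walk.edges_reverse, List.count_append, List.count_append,
      List.count_reverse]
  have hρv : ∀ e ∈ ρ.edges, v ∉ e := fun e he hve => hvρ (mem_support_of_mem_edges_of_mem ρ he hve)
  have hc1 : C.edges.count s(v, t) = 1 := by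
    rw [hcount, count_edges_eq_one_of_count_le_one A₁ hcA₁ hvtA₁ (Sym2.mem_mk_left _ _),
      List.count_eq_zero.2 (fun h' => hρv _ h' (Sym2.mem_mk_left _ _)),
      List.count_eq_zero.2 (fun h' => heγt (heA₂ _ h' (Sym2.mem_mk_left _ _)).symm)]
  have hc2 : C.edges.count eγ = 1 := by
    rw [hcount, List.count_eq_zero.2 (fun h' => heγt (heA₁ _ h' hveγ)),
      List.count_eq_zero.2 (fun h' => hρv _ h' hveγ), count_edges_eq_one_of_count_le_one A₂ hcA₂ heγA₂ hveγ]
  have hc3 : ∀ e ∈ C.edges, v ∈ e → e = s(v, t) ∨ e = eγ := by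
    intro e he hve
    rcases (hCedges e).1 he with he | he | he
    · exact Or.inl (heA₁ e he hve)
    · exact absurd hve (hρv e he)
    · exact Or.inr (heA₂ e he hve)
  have hne := hloc C hc1 hc2 hc3
  -- but both winding numbers vanish
  have hWh₁ : walkWinding C h₁ = 0 := by
    rw [walkWinding_closed_eq_of_faceWalk C Δ fun dq hdq hmem => hΔ dq hdq (hCω _ hmem)]
    exact walkWinding_eq_zero_of_le (N := z 1 + n) (fun w hw => (hCsupp w hw).2) hf₀
  have hWg : walkWinding C g = 0 := by
    obtain ⟨b₀, hb₀, hconn₀⟩ := exists_openConnIn_dualBelow hg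
    obtain ⟨Q₀, -, hQ₀e⟩ :=
      exists_walk_of_mem_openConnIn (fun _ h => h.1 : dualConfig ω ⊆ (zdGraph 2).edgeSet) hconn₀
    have hQ₀d := (forall_edges_mem_dualConfig_iff Q₀).1 hQ₀e
    rw [← walkWinding_closed_eq_of_faceWalk C Q₀ fun dq hdq hmem => hQ₀d dq hdq (hCω _ hmem)]
    have hb₀1 : b₀ 1 = -1 := (Finset.mem_filter.1 hb₀).2
    exact walkWinding_eq_zero_of_ge (L := z 1 - n) (fun w hw => (hCsupp w hw).1) (by rw [hb₀1]; omega)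
  exact hne (by rw [hWh₁, hWg])

/-- Arithmetic in `Fin 4`. [folklore] -/
private theorem fin4_add_one_sub_one (k : Fin 4) : k + 1 - 1 = k := by revert k; decide
/-- Arithmetic in `Fin 4`. [folklore] -/
private theorem fin4_add_two_sub_one (k : Fin 4) : k + 2 - 1 = k + 1 := by revert k; decide
/-- Arithmetic in `Fin 4`. [folklore] -/
private theorem fin4_sub_one_sub_one (k : Fin 4) : k - 1 - 1 = k + 2 := by revert k; decide
/-- Arithmetic in `Fin 4`. [folklore] -/
private theorem fin4_sub_one_add_three (k : Fin 4) : k - 1 = k + 3 := by revert k; decide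
/-- Arithmetic in `Fin 4`. [folklore] -/
private theorem fin4_cases (k d : Fin 4) : d = k ∨ d = k + 1 ∨ d = k + 2 ∨ d = k + 3 := by
  revert k d; decide
/-- Arithmetic in `Fin 4`. [folklore] -/
private theorem fin4_add_three_ne_add_one (k : Fin 4) : k + 3 ≠ k + 1 := by revert k; decide
/-- Arithmetic in `Fin 4`. [folklore] -/
private theorem fin4_add_one_add_one (k : Fin 4) : k + 1 + 1 = k + 2 := by revert k; decide
/-- Arithmetic in `Fin 4`. [folklore] -/
private theorem fin4_add_two_add_one (k : Fin 4) : k + 2 + 1 = k - 1 := by revert k; decide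

/-- The endpoints of the edges at `v` have first coordinate `≤ v₀ + 1`. [folklore] -/
theorem apply_zero_le_of_mem_vxEdge {v w : Site 2} {k : Fin 4} (hw : w ∈ vxEdge v k) : w 0 ≤ v 0 + 1 := by
  have h1 : v 0 ≤ v 0 + 1 + 1 := by linarith
  fin_cases k <;> simp at hw <;> rcases hw with rfl | rfl <;> simp [h1]

/-- **Five arms at a vertex of the lowest crossing give the five-arm event** (the form used in the
lower bound): as `relabel_shift_mem_zdFiveArmClusters_of_local`, with the local separation
property DERIVED from the geometry of the lowest crossing around `v` — the faces of the landing
edge have winding number `≠ -1` for the extended crossing (its far endpoint `t` is strictly above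
`π`), the faces of `D₀` have winding number `-1`, and every edge of `π` bounds exactly one face of
`D₀`; the edge `eγ` of `π` at `v` and the face `g ∈ D₀` are chosen by the position of `h₁`
(Kesten 1982, §2.3, the lowest crossing as the boundary of the faces joined to the bottom).
[cite: Nolin2008, §5.2, proof of Thm. 24 (ii) (arXiv 0711.4948: Thm. 23 (ii))] -/
theorem relabel_shift_mem_zdFiveArmClusters_of_arms (hω : ω ⊆ (zdGraph 2).edgeSet)
    (hπ : IsSquareCrossing j π) (hpath : π.IsPath) (hbdry : ∀ d ∈ π.darts, IsBdryEdge (dualBelow j ω) j d.edge)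
    {v t : Site 2} (hv : v ∈ π.support) (hva : v ≠ a) (hvb : v ≠ b) (hv0 : 1 ≤ v 0) (hv0' : v 0 + 1 ≤ j)
    (hv1 : 1 ≤ v 1) (hvt : (zdGraph 2).Adj v t) (hvtω : s(v, t) ∈ ω)
    (hWt : ∀ f ∈ dualEdge s(v, t), walkWinding (extendRight π 0) f ≠ -1)
    {s : Site 2} (P : (zdGraph 2).Walk t s) (hPπ : ∀ x ∈ P.support, x ∉ π.support)
    (hPω : ∀ e ∈ P.edges, e ∈ ω) {h₁ f₀ : Site 2} (hh₁ : h₁ ∈ dualEdge s(v, t)) (Δ : (zdGraph 2).Walk h₁ f₀)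
    (hΔ : ∀ d ∈ Δ.darts, sepEdge d.fst d.snd ∉ ω)
    (z : Site 2) {m n : ℕ} (hm : 1 ≤ m) (hmn : m ≤ n) (hvz : v - z ∈ box 2 (m - 1))
    (hf₀ : z 1 + n ≤ f₀ 1) (hzn : 1 ≤ z 1 - n)
    (hPfar : ∃ x ∈ P.support, x - z ∉ box 2 (n - 1))
    (hLfar : ∃ x ∈ (π.takeUntil v hv).support, x - z ∉ box 2 (n - 1))
    (hRfar : ∃ x ∈ (π.dropUntil v hv).support, x - z ∉ box 2 (n - 1)) :
    BondConfig.relabel (sym2Equiv (Site.shift (-z))) ω ∈ zdFiveArmClusters m n := by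
  classical
  set D₀ := dualBelow j ω with hD₀
  set Wπ := walkWinding (extendRight π 0) with hWπ
  have htπ : t ∉ π.support := hPπ t P.start_mem_support
  -- the landing edge is `vxEdge v k₀`
  obtain ⟨k₀, hk₀⟩ := exists_vxEdge_eq ((zdGraph 2).mem_edgeSet.2 hvt) (Sym2.mem_mk_left v t)
  -- (F1) faces of `D₀` have winding number `-1`; (F2) the faces of the landing edge are not in `D₀`
  have hF1 : ∀ {f : Site 2}, f ∈ D₀ → Wπ f = -1 := fun hf => hπ.walkWinding_ext_of_mem hbdry rfl hf
  -- (F3) an edge at `v` off `π` separates faces of equal winding number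
  have hray_a : ∀ k, a ∉ rayAbove (vxFace v k) := fun k =>
    hπ.start_notMem_rayAbove' (by have := (vxFace_apply_le (v := v) k 0).2; omega)
  have hray_b : ∀ k, _ ∉ rayAbove (vxFace v k) := fun k =>
    hπ.ext_end_notMem_rayAbove (by have := (vxFace_apply_le (v := v) k 1).2; omega)
  have hF3 : ∀ k, vxEdge v k ∉ π.edges → Wπ (vxFace v (k - 1)) = Wπ (vxFace v k) := by
    intro k hk
    refine walkWinding_vxFace_eq_of_notMem' (extendRight π 0) k (fun hmem => ?_) hray_a hray_b
    rcases mem_edges_extendRight hmem with h' | ⟨w, hw, hw0⟩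
    · exact hk h'
    · have := apply_zero_le_of_mem_vxEdge hw
      rw [hπ.finish] at hw0
      omega
  -- (F4) boundary edges: the `D₀`-face of an edge of `π`
  have hF4 : ∀ k, vxEdge v k ∈ π.edges → ∀ {f f' : Site 2}, s(f, f') = s(vxFace v (k - 1), vxFace v k) →
      Wπ f ≠ -1 → f' ∈ D₀ := by
    intro k hk f f' hff' hWf
    rw [Walk.edges, List.mem_map] at hk
    obtain ⟨d, hd, hde⟩ := hk
    obtain ⟨g₁, g₂, hdual, -, -, hg₁, hg₂⟩ := hbdry d hd
    rw [hde, dualEdge_vxEdge, ← hff', Sym2.eq_iff] at hdual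
    rcases hdual with ⟨rfl, rfl⟩ | ⟨rfl, rfl⟩
    · exact absurd (hF1 hg₁) hWf
    · exact hg₁
  -- (F5) the two edges of `π` at `v`
  have hF5 : ∃ E₁ ∈ π.edges, ∃ E₂ ∈ π.edges, v ∈ E₁ ∧ v ∈ E₂ ∧ E₁ ≠ E₂ := by
    obtain ⟨E₁, hE₁, hvE₁⟩ := exists_mem_edges_start (π.takeUntil v hv).reverse (fun h => hva (h ▸ rfl) |>.elim)
    obtain ⟨E₂, hE₂, hvE₂⟩ := exists_mem_edges_start (π.dropUntil v hv) (Ne.symm hvb)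
    rw [Walk.edges_reverse, List.mem_reverse] at hE₁
    refine ⟨E₁, π.edges_takeUntil_subset_edges hv hE₁, E₂, π.edges_dropUntil_subset_edges hv hE₂, hvE₁, hvE₂,
      fun heq => ?_⟩
    have hnd : (π.takeUntil v hv).edges ++ (π.dropUntil v hv).edges = π.edges := by
      rw [← Walk.edges_append, Walk.take_spec]
    have hnodup : ((π.takeUntil v hv).edges ++ (π.dropUntil v hv).edges).Nodup := by
      rw [hnd]; exact hpath.isTrail.edges_nodup
    exact List.disjoint_of_nodup_append hnodup hE₁ (heq ▸ hE₂)
  have hvtπ : s(v, t) ∉ π.edges := fun h' => htπ (π.snd_mem_support_of_mem_edges h')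
  -- every edge of `π` at `v` other than `vxEdge v k₁` (off `π`) is `vxEdge v (k₀+2)` or the fourth one
  have hopp : ∀ k₁, vxEdge v k₁ ∉ π.edges → (k₁ = k₀ + 1 ∨ k₁ = k₀ + 3) → vxEdge v (k₀ + 2) ∈ π.edges := by
    intro k₁ hk₁ hk₁'
    obtain ⟨E₁, hE₁, E₂, hE₂, hvE₁, hvE₂, hne⟩ := hF5
    obtain ⟨d₁, rfl⟩ := exists_vxEdge_eq (π.edges_subset_edgeSet hE₁) hvE₁
    obtain ⟨d₂, rfl⟩ := exists_vxEdge_eq (π.edges_subset_edgeSet hE₂) hvE₂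
    have key : ∀ d, vxEdge v d ∈ π.edges → d = k₀ + 2 ∨ d = (if k₁ = k₀ + 1 then k₀ + 3 else k₀ + 1) := by
      intro d hd
      rcases fin4_cases k₀ d with rfl | rfl | rfl | rfl
      · exact absurd hd (hk₀ ▸ hvtπ)
      · rcases hk₁' with rfl | rfl
        · exact absurd hd hk₁
        · right; rw [if_neg (fin4_add_three_ne_add_one k₀)]
      · exact Or.inl rfl
      · rcases hk₁' with rfl | rfl
        · right; rw [if_pos rfl]
        · exact absurd hd hk₁
    rcases key d₁ hE₁ with h1 | h1
    · exact h1 ▸ hE₁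
    · rcases key d₂ hE₂ with h2 | h2
      · exact h2 ▸ hE₂
      · exact absurd (by rw [h1, h2]) hne
  -- ### the local case analysis: position of `h₁` relative to the landing edge
  rw [hk₀] at hh₁
  rcases (mem_dualEdge_vxEdge_iff k₀).1 hh₁ with rfl | rfl
  · -- case (ii): `h₁ = F(k₀ - 1)`; the other edge of `h₁` at `v` is `E' = vxEdge v (k₀ - 1)`
    have hWh₁ : Wπ (vxFace v (k₀ - 1)) ≠ -1 := hWt _ (by rw [hk₀]; exact hh₁)
    by_cases hE' : vxEdge v (k₀ - 1) ∈ π.edges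
    · -- sub-case A: `eγ = E'`, `g = F(k₀ - 2)`
      have hg : vxFace v (k₀ - 1 - 1) ∈ D₀ :=
        hF4 (k₀ - 1) hE' (by rw [Sym2.eq_swap]) hWh₁
      refine relabel_shift_mem_zdFiveArmClusters_of_local hω hpath hbdry hv hvt hvtω P hPπ hPω Δ hΔ hE'
        (mem_vxEdge _) (by rw [hk₀]; exact vxEdge_sub_one_ne k₀) hg (fun C _ hc2 _ => ?_) z hm hmn hvz hf₀ hzn
        hPfar hLfar hRfar
      exact (walkWinding_vxFace_ne_of_count C (k₀ - 1) hc2).symm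
    · -- sub-case B: `eγ = vxEdge v (k₀ + 2)` (opposite the landing edge), `g = F(k₀ + 1)` (diagonal)
      have heopp : vxEdge v (k₀ + 2) ∈ π.edges := hopp (k₀ - 1) hE' (Or.inr (fin4_sub_one_add_three k₀))
      have hWh₀ : Wπ (vxFace v (k₀ - 1 - 1)) ≠ -1 := by rw [hF3 (k₀ - 1) hE']; exact hWh₁
      have hg : vxFace v (k₀ + 2 - 1) ∈ D₀ := by
        refine hF4 (k₀ + 2) heopp (by rw [Sym2.eq_swap]) ?_
        rw [fin4_sub_one_sub_one] at hWh₀; exact hWh₀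
      refine relabel_shift_mem_zdFiveArmClusters_of_local hω hpath hbdry hv hvt hvtω P hPπ hPω Δ hΔ heopp
        (mem_vxEdge _) (by rw [hk₀]; exact vxEdge_add_two_ne k₀) hg (fun C hc1 hc2 hc3 => ?_) z hm hmn hvz
        hf₀ hzn hPfar hLfar hRfar
      have hE'C : vxEdge v (k₀ - 1) ∉ C.edges := by
        intro hmem
        rcases hc3 _ hmem (mem_vxEdge _) with h' | h'
        · rw [hk₀] at h'; exact vxEdge_sub_one_ne k₀ h'
        · have : vxEdge v (k₀ + 2 + 1) ≠ vxEdge v (k₀ + 2) := vxEdge_add_one_ne (k₀ + 2)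
          rw [fin4_add_two_add_one] at this
          exact this h'
      have h1 := walkWinding_vxFace_eq_of_notMem C (k₀ - 1) hE'C
      have h2 := walkWinding_vxFace_ne_of_count C (k₀ + 2) hc2
      rw [fin4_sub_one_sub_one] at h1
      rw [← h1]
      exact h2.symm
  · -- case (i): `h₁ = F k₀`; the other edge of `h₁` at `v` is `E' = vxEdge v (k₀ + 1)`
    have hWh₁ : Wπ (vxFace v k₀) ≠ -1 := hWt _ (by rw [hk₀]; exact hh₁)
    by_cases hE' : vxEdge v (k₀ + 1) ∈ π.edges
    · -- sub-case A: `eγ = E'`, `g = F(k₀ + 1)`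
      have hg : vxFace v (k₀ + 1) ∈ D₀ :=
        hF4 (k₀ + 1) hE' (by rw [fin4_add_one_sub_one]) hWh₁
      refine relabel_shift_mem_zdFiveArmClusters_of_local hω hpath hbdry hv hvt hvtω P hPπ hPω Δ hΔ hE'
        (mem_vxEdge _) (by rw [hk₀]; exact vxEdge_add_one_ne k₀) hg (fun C _ hc2 _ => ?_) z hm hmn hvz hf₀ hzn
        hPfar hLfar hRfar
      have := walkWinding_vxFace_ne_of_count C (k₀ + 1) hc2
      rwa [fin4_add_one_sub_one] at this
    · -- sub-case B: `eγ = vxEdge v (k₀ + 2)`, `g = F(k₀ + 2)` (diagonal)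
      have heopp : vxEdge v (k₀ + 2) ∈ π.edges := hopp (k₀ + 1) hE' (Or.inl rfl)
      have hWh₀ : Wπ (vxFace v (k₀ + 1)) ≠ -1 := by
        rw [← hF3 (k₀ + 1) hE', fin4_add_one_sub_one]; exact hWh₁
      have hg : vxFace v (k₀ + 2) ∈ D₀ := by
        refine hF4 (k₀ + 2) heopp rfl ?_
        rw [fin4_add_two_sub_one]; exact hWh₀
      refine relabel_shift_mem_zdFiveArmClusters_of_local hω hpath hbdry hv hvt hvtω P hPπ hPω Δ hΔ heopp
        (mem_vxEdge _) (by rw [hk₀]; exact vxEdge_add_two_ne k₀) hg (fun C hc1 hc2 hc3 => ?_) z hm hmn hvz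
        hf₀ hzn hPfar hLfar hRfar
      have hE'C : vxEdge v (k₀ + 1) ∉ C.edges := by
        intro hmem
        rcases hc3 _ hmem (mem_vxEdge _) with h' | h'
        · rw [hk₀] at h'; exact vxEdge_add_one_ne k₀ h'
        · have : vxEdge v (k₀ + 1 + 1) ≠ vxEdge v (k₀ + 1) := vxEdge_add_one_ne (k₀ + 1)
          rw [fin4_add_one_add_one] at this
          exact this h'.symm
      have h1 := walkWinding_vxFace_eq_of_notMem C (k₀ + 1) hE'C
      have h2 := walkWinding_vxFace_ne_of_count C (k₀ + 2) hc2
      rw [fin4_add_one_sub_one] at h1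
      rw [fin4_add_two_sub_one] at h2
      rw [h1]
      exact h2

end Core




end Literature.Probability.Percolation
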